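import Mathlib
import Literature.Probability.LatticeModels.IsoradialPercolation
import Literature.Probability.Percolation.PercolationEvents
import HarnessLib

/-!
# Crux `PercNearOneGluing.NoHeavyLowerTail` (stmt-CriticalPhenomena-4575), line `finger-induction` — definitions

The one object the line `finger-induction` (strategy (b): induction on the number of fingers) of the
crux `Summit.CriticalPhenomena.PercolationContinuityZ3.Theses.PercNearOneGluing.NoHeavyLowerTail` posits:
the INDUCTIVE INVARIANT `FingerInv ε δ m` — Kozma–Nitzan's near-one gluing (arXiv:2401.12397,
Conjecture 3) in HUB FORM, restricted to the first `m` finger levels.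

Setting: a finite weighted graph on `Fin n` (`P = prodBernoulli w`, independent edges), a relay set `A`,
a hub `a₀ ∈ A`, an observer `o ∉ A`; the STAR budget `P(a ↮ a₀) ≤ δ` for every `a ∈ A` and the
OBSERVER budget `P(o ↮ A) ≤ δ`.  The FINGER COUNT of a configuration `ω` is
`N'(ω) = #{a ∈ A ∖ a₀ : o ↔ a}` (relay points other than the hub joined to `o` by an open path).
`FingerInv ε δ m` says: on every such instance, `P(o ↮ a₀ ∧ 1 ≤ N' ≤ m) ≤ ε`.

The crux is equivalent to `∀ ε > 0, ∃ δ > 0, ∀ m, FingerInv ε δ m` (both directions are proved in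
`Theorems/PercNearOneGluingNoHeavyLowerTailFingerInduction.lean`); the line climbs the levels `m`.
Nothing here asserts anything about the crux.
-/

namespace Summit.CriticalPhenomena.PercolationContinuityZ3.Theorems

open scoped Classical
open MeasureTheory
open Literature.Probability.LatticeModels (prodBernoulli)
open Literature.Probability.Percolation (openConn BondConfig)

/-- **The inductive invariant of the finger induction** (hub form of Kozma–Nitzan Conjecture 3 at the
first `m` finger levels): for every finite weighted graph, relay set `A`, hub `a₀ ∈ A` and observer
`o ∉ A` with star budget `P(a ↮ a₀) ≤ δ` (`a ∈ A`) and observer budget `P(o ↮ A) ≤ δ`, the event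
"`o ↮ a₀` and `o` is joined to at least `1` and at most `m` points of `A ∖ a₀`" has probability `≤ ε`.
[this work] -/
def FingerInv (ε δ : ℝ) (m : ℕ) : Prop :=
  ∀ (n : ℕ) (w : Sym2 (Fin n) → unitInterval) (A : Finset (Fin n)) (o a₀ : Fin n),
    a₀ ∈ A → o ∉ A →
    (∀ a ∈ A, (prodBernoulli w).real (openConn a a₀)ᶜ ≤ δ) →
    (prodBernoulli w).real (⋃ a ∈ A, openConn o a)ᶜ ≤ δ →
    (prodBernoulli w).real {ω : BondConfig (Fin n) | ω ∉ openConn o a₀ ∧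
        1 ≤ ((A.erase a₀).filter fun a => ω ∈ openConn o a).card ∧
        ((A.erase a₀).filter fun a => ω ∈ openConn o a).card ≤ m} ≤ ε

/-- Unfolding lemma for `FingerInv`. [this work] -/
theorem fingerInv_iff (ε δ : ℝ) (m : ℕ) :
    FingerInv ε δ m ↔
      ∀ (n : ℕ) (w : Sym2 (Fin n) → unitInterval) (A : Finset (Fin n)) (o a₀ : Fin n),
        a₀ ∈ A → o ∉ A →
        (∀ a ∈ A, (prodBernoulli w).real (openConn a a₀)ᶜ ≤ δ) →
        (prodBernoulli w).real (⋃ a ∈ A, openConn o a)ᶜ ≤ δ →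
        (prodBernoulli w).real {ω : BondConfig (Fin n) | ω ∉ openConn o a₀ ∧
            1 ≤ ((A.erase a₀).filter fun a => ω ∈ openConn o a).card ∧
            ((A.erase a₀).filter fun a => ω ∈ openConn o a).card ≤ m} ≤ ε :=
  Iff.rfl

/-- **Monotonicity of the invariant**: a larger tolerance `ε`, a smaller budget `δ` and fewer levels
`m` all weaken the statement. [this work] -/
theorem fingerInv_mono {ε ε' δ δ' : ℝ} {m m' : ℕ} (hε : ε ≤ ε') (hδ : δ' ≤ δ) (hm : m' ≤ m)
    (h : FingerInv ε δ m) : FingerInv ε' δ' m' := by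
  intro n w A o a₀ ha₀ ho hstar hobs
  have hstar' : ∀ a ∈ A, (prodBernoulli w).real (openConn a a₀)ᶜ ≤ δ :=
    fun a ha => (hstar a ha).trans hδ
  refine le_trans (le_trans (measureReal_mono ?_) (h n w A o a₀ ha₀ ho hstar' (hobs.trans hδ))) hε
  rintro ω ⟨h1, h2, h3⟩
  exact ⟨h1, h2, h3.trans hm⟩

/-- At level `m = 0` the event is empty, so the invariant holds for every `ε ≥ 0`. [this work] -/
theorem fingerInv_level_zero {ε : ℝ} (δ : ℝ) (hε : 0 ≤ ε) : FingerInv ε δ 0 := by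
  intro n w A o a₀ _ _ _ _
  have hempty : {ω : BondConfig (Fin n) | ω ∉ openConn o a₀ ∧
      1 ≤ ((A.erase a₀).filter fun a => ω ∈ openConn o a).card ∧
      ((A.erase a₀).filter fun a => ω ∈ openConn o a).card ≤ 0} = ∅ := by
    ext ω
    simp only [Set.mem_setOf_eq, Set.mem_empty_iff_false, iff_false, not_and, not_le]
    intro _ h1
    omega
  rw [hempty, measureReal_empty]
  exact hε

end Summit.CriticalPhenomena.PercolationContinuityZ3.Theorems
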